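import Mathlib
import HarnessLib

/-!
# `NoHeavyLowerTail` (crux stmt-CriticalPhenomena-4575), antithetic vdBHK programme: the STALK TRANSFER IDENTITY — the rearrangement
# functional (R) of a rooted poset embeds isometrically into that of the poset with a new atom hung below any atom

Support file (seat `prim-ineq-gen-7` gen 54; `--supports stmt-CriticalPhenomena-4575`).  No `sorry`, no definitions.
Memo: run/shared/lean/prim/prim-ineq-gen-7/FINDING-STALK-g54.md (THEOREM S); earlier objects: FINDING-FLOW-g50.md §4h ((R)), OPEN-HEREDITY-g51.md,
FINDING-UNCROSS-g53.md RESULT 8 (the 'W on a stalk' failure `P6_81` and CONJECTURE S, which THEOREM S proves in strong form).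

SETTING (memo §1).  `Q` a finite poset, `a` an atom (the root), `u` ANY atom of `Q` (`u = a` allowed), `Q_u := Q ⊔ {e}` with `e < u` a new atom hung
below `u`; root `a' = a` (`u ≠ a`) or `a' = e` (`u = a`, the STALK).  `T = TQ = Ω_{Q ∪_a wedge}` and `Z = TQ' = Ω_{Q_u ∪_{a'} wedge}` are the colouring
posets on which the rearrangement functionals `R(𝐀,𝐁) = #(𝐀 ∩ 𝐁) - #(𝐀 ∩ ι′𝐁)` of `(Q,a)` resp. `(Q_u,a')` live ((R) ⟺ `R ≥ 0` on all pairs of up-sets;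
`ι′` flips the wedge and, on the inner wedge sheets, all other colours).  The DIAGONAL map `δ : T → Z` colours `e` like `u`; the classes of `Z` by
(colour of `e`, colour of `u`) are the diagonal `δ(T)`, `C10` (e red, u blue; a down-set of `Z`) and `C01` (e blue, u red; an up-set of `Z`); `ι′_Z`
exchanges `C10` and `C01` on the inner sheets and preserves them on the outer sheets, and `ι′_Z ∘ δ = δ ∘ ι′_T`.  THEOREM S (memo §2, pencil proof +
machine verification on 110 rooted bases): for up-sets `𝐀, 𝐁` of `T` the sets `𝐀* = Int↑(↑δ𝐀 ∪ C10)` and `𝐁* = ↑δ𝐁 ∪ C01` are up-sets of `Z` with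
`𝐀* ∩ δT = δ𝐀`, `𝐁* ∩ δT = δ𝐁`, `𝐁* ∩ C10 = ∅`, and the BALANCE `#(𝐀* ∩ C01 ∩ inner) = #(𝐀* ∩ C10 ∩ inner)` (both sides are indexed by the same
set of 'other colours' `w`, memo LEMMA B); this file proves the purely finite-set consequence
* `AntitheticStalk.card_split3` — splitting a filter-count of `𝐀*` over the three classes;
* `AntitheticStalk.stalk_transfer` — **R_Z(𝐀*,𝐁*) = R_T(𝐀,𝐁)**: under the listed abstract hypotheses (no order is needed at this point) the
  rearrangement functional is preserved exactly.  Hence `min R(Q_u,a') ≤ min R(Q,a)`: every failure of (R) persists, with at least the same deficit,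
  under hanging chains below atoms (CONJECTURE S of g53; the bases `P6_81`, `W@mid + stalk`, `K_{1,3} + stalk`, `F₇@atom1 + stalk` all fail).
-/

namespace Summit.CriticalPhenomena.PercolationContinuityZ3.Theorems

open Finset

namespace AntitheticStalk

variable {T Z : Type*} [DecidableEq T] [DecidableEq Z]

omit [DecidableEq T] in
/-- Three-class split of a filter count: if every point of `As` is a `δ`-image of a point of `A`, or lies in `C10`, or lies in `C01` (the three being
mutually exclusive, and `δ s ∈ As ↔ s ∈ A`), then for every decidable predicate `P`,
`#(As.filter P) = #(A.filter (P ∘ δ)) + #((As ∩ C10).filter P) + #((As ∩ C01).filter P)`. [this work] -/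
theorem card_split3 (δ : T → Z) (hδ : Function.Injective δ) (C10 C01 : Finset Z)
    (hC : Disjoint C10 C01) (hC10 : ∀ s, δ s ∉ C10) (hC01 : ∀ s, δ s ∉ C01)
    (A : Finset T) (As : Finset Z)
    (hAs : ∀ z ∈ As, (∃ s ∈ A, δ s = z) ∨ z ∈ C10 ∨ z ∈ C01) (hAδ : ∀ s, δ s ∈ As ↔ s ∈ A)
    (P : Z → Prop) [DecidablePred P] :
    (As.filter P).card = (A.filter (fun s => P (δ s))).card + ((As ∩ C10).filter P).card + ((As ∩ C01).filter P).card := by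
  classical
  -- split As.filter P by membership in C10, then the remainder by membership in C01
  have e1 : (As.filter P).card = ((As.filter P).filter (fun z => z ∈ C10)).card + ((As.filter P).filter (fun z => z ∉ C10)).card := by
    rw [Finset.card_filter_add_card_filter_not]
  have e2 : ((As.filter P).filter (fun z => z ∉ C10)).card =
      (((As.filter P).filter (fun z => z ∉ C10)).filter (fun z => z ∈ C01)).card +
      (((As.filter P).filter (fun z => z ∉ C10)).filter (fun z => z ∉ C01)).card := by
    rw [Finset.card_filter_add_card_filter_not]
  have i1 : (As.filter P).filter (fun z => z ∈ C10) = (As ∩ C10).filter P := by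
    ext z; simp only [Finset.mem_filter, Finset.mem_inter]; tauto
  have i2 : ((As.filter P).filter (fun z => z ∉ C10)).filter (fun z => z ∈ C01) = (As ∩ C01).filter P := by
    ext z; simp only [Finset.mem_filter, Finset.mem_inter]
    constructor
    · rintro ⟨⟨⟨h1, h2⟩, _⟩, h4⟩; exact ⟨⟨h1, h4⟩, h2⟩
    · rintro ⟨⟨h1, h4⟩, h2⟩
      exact ⟨⟨⟨h1, h2⟩, fun h3 => (Finset.disjoint_left.mp hC) h3 h4⟩, h4⟩
  have i3 : ((As.filter P).filter (fun z => z ∉ C10)).filter (fun z => z ∉ C01) = (A.filter (fun s => P (δ s))).image δ := by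
    ext z; simp only [Finset.mem_filter, Finset.mem_image]
    constructor
    · rintro ⟨⟨⟨h1, h2⟩, h3⟩, h4⟩
      rcases hAs z h1 with ⟨s, hs, rfl⟩ | h | h
      · exact ⟨s, ⟨hs, h2⟩, rfl⟩
      · exact absurd h h3
      · exact absurd h h4
    · rintro ⟨s, ⟨hs, hP⟩, rfl⟩
      exact ⟨⟨⟨(hAδ s).mpr hs, hP⟩, hC10 s⟩, hC01 s⟩
  have i4 : ((A.filter (fun s => P (δ s))).image δ).card = (A.filter (fun s => P (δ s))).card :=
    Finset.card_image_of_injective _ hδ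
  rw [i1] at e1; rw [i2, i3, i4] at e2
  omega

/-- **THE STALK TRANSFER IDENTITY `R_Z(𝐀*,𝐁*) = R_T(𝐀,𝐁)`.**  Abstract data: `δ : T → Z` injective intertwining the involutions
(`κ (δ s) = δ (ι' s)`); disjoint classes `C10, C01 ⊆ Z` avoiding `δ(T)`; a decidable predicate `inner` on `Z` such that `κ` maps inner points of
`C10` into `C01` and of `C01` into `C10`, and outer points of each class into the same class; `𝐀* ⊆ δ𝐀 ∪ C10 ∪ C01` with `𝐀* ∩ δT = δ𝐀`;
`𝐁* ⊆ δ𝐁 ∪ C01` with `𝐁* ∩ δT = δ𝐁` and `C01 ⊆ 𝐁*`; and the BALANCE `#(𝐀* ∩ C01 ∩ inner) = #(𝐀* ∩ C10 ∩ inner)`.  Then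
`#(𝐀* ∩ 𝐁*) - #{z ∈ 𝐀* : κ z ∈ 𝐁*} = #(𝐀 ∩ 𝐁) - #{s ∈ 𝐀 : ι' s ∈ 𝐁}` (over `ℤ`).  In the application (THEOREM S of the memo) `T, Z` are the
colouring posets of `Q ∪_a wedge` and `Q_u ∪_{a'} wedge`, `κ, ι'` their wedge-flip involutions, and all hypotheses are the order-theoretic lemmas
A (diagonal embedding and convexity), B (balance bijection `w ↦ w`) and C (class transitions) proved there. [this work] -/
theorem stalk_transfer (δ : T → Z) (hδ : Function.Injective δ) (ι' : T → T) (κ : Z → Z)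
    (hκδ : ∀ s, κ (δ s) = δ (ι' s))
    (C10 C01 : Finset Z) (inner : Z → Prop) [DecidablePred inner]
    (hC : Disjoint C10 C01) (hC10 : ∀ s, δ s ∉ C10) (hC01 : ∀ s, δ s ∉ C01)
    (hκ10i : ∀ z ∈ C10, inner z → κ z ∈ C01) (hκ10o : ∀ z ∈ C10, ¬ inner z → κ z ∈ C10)
    (hκ01i : ∀ z ∈ C01, inner z → κ z ∈ C10) (hκ01o : ∀ z ∈ C01, ¬ inner z → κ z ∈ C01)
    (A B : Finset T) (As Bs : Finset Z)
    (hAs : ∀ z ∈ As, (∃ s ∈ A, δ s = z) ∨ z ∈ C10 ∨ z ∈ C01) (hAδ : ∀ s, δ s ∈ As ↔ s ∈ A)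
    (hBs : ∀ z ∈ Bs, (∃ s ∈ B, δ s = z) ∨ z ∈ C01) (hBδ : ∀ s, δ s ∈ Bs ↔ s ∈ B) (hB01 : C01 ⊆ Bs)
    (hbal : ((As ∩ C01).filter (fun z => inner z)).card = ((As ∩ C10).filter (fun z => inner z)).card) :
    ((As ∩ Bs).card : ℤ) - ((As.filter (fun z => κ z ∈ Bs)).card : ℤ)
      = ((A ∩ B).card : ℤ) - ((A.filter (fun s => ι' s ∈ B)).card : ℤ) := by
  classical
  -- no point of C10 lies in Bs
  have hB10 : ∀ z ∈ C10, z ∉ Bs := by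
    intro z hz hzB
    rcases hBs z hzB with ⟨s, _, rfl⟩ | h
    · exact hC10 s hz
    · exact (Finset.disjoint_left.mp hC) hz h
  -- (1) the straight term
  have s0 : (As ∩ Bs).card = (As.filter (fun z => z ∈ Bs)).card := by
    rw [Finset.filter_mem_eq_inter]
  have s1 := card_split3 δ hδ C10 C01 hC hC10 hC01 A As hAs hAδ (fun z => z ∈ Bs)
  have s1a : (A.filter (fun s => δ s ∈ Bs)) = A ∩ B := by
    ext s; simp only [Finset.mem_filter, Finset.mem_inter, hBδ]
  have s1b : ((As ∩ C10).filter (fun z => z ∈ Bs)).card = 0 := by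
    rw [Finset.card_eq_zero, Finset.filter_eq_empty_iff]
    intro z hz; rw [Finset.mem_inter] at hz; exact hB10 z hz.2
  have s1c : ((As ∩ C01).filter (fun z => z ∈ Bs)) = As ∩ C01 := by
    rw [Finset.filter_eq_self]
    intro z hz; rw [Finset.mem_inter] at hz; exact hB01 hz.2
  -- (2) the twisted term
  have t1 := card_split3 δ hδ C10 C01 hC hC10 hC01 A As hAs hAδ (fun z => κ z ∈ Bs)
  have t1a : (A.filter (fun s => κ (δ s) ∈ Bs)) = A.filter (fun s => ι' s ∈ B) := by
    ext s; simp only [Finset.mem_filter, hκδ, hBδ]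
  have t1b : ((As ∩ C10).filter (fun z => κ z ∈ Bs)) = (As ∩ C10).filter (fun z => inner z) := by
    ext z; simp only [Finset.mem_filter, Finset.mem_inter]
    constructor
    · rintro ⟨⟨h1, h2⟩, h3⟩
      refine ⟨⟨h1, h2⟩, ?_⟩
      by_contra hni
      exact hB10 _ (hκ10o z h2 hni) h3
    · rintro ⟨⟨h1, h2⟩, h3⟩
      exact ⟨⟨h1, h2⟩, hB01 (hκ10i z h2 h3)⟩
  have t1c : ((As ∩ C01).filter (fun z => κ z ∈ Bs)) = (As ∩ C01).filter (fun z => ¬ inner z) := by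
    ext z; simp only [Finset.mem_filter, Finset.mem_inter]
    constructor
    · rintro ⟨⟨h1, h2⟩, h3⟩
      refine ⟨⟨h1, h2⟩, ?_⟩
      intro hi
      exact hB10 _ (hκ01i z h2 hi) h3
    · rintro ⟨⟨h1, h2⟩, h3⟩
      exact ⟨⟨h1, h2⟩, hB01 (hκ01o z h2 h3)⟩
  -- (3) inner/outer split of As ∩ C01
  have u1 : (As ∩ C01).card = ((As ∩ C01).filter (fun z => inner z)).card + ((As ∩ C01).filter (fun z => ¬ inner z)).card := by
    rw [Finset.card_filter_add_card_filter_not]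
  rw [s1a, s1b, s1c] at s1
  rw [t1a, t1b, t1c] at t1
  rw [s0, s1, t1]
  push_cast
  omega

end AntitheticStalk

end Summit.CriticalPhenomena.PercolationContinuityZ3.Theorems
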